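/-
Copyright (c) 2026 the pub-hodgecm-mathlib formalisation cell (harness21).  Prover seat hodgecm-mathlib-K2E1-p12 (g2), Track B ∕ K2-LIT, h413 = `stmt-HodgeConjecture-24833`,
line `K2_E1_TraceFormulaBeta`, dealer K2E1-plan (g7) (182)∕(225): the `L²` RESIDUE CLASS OF THE TRUNCATED SPHERICAL EISENSTEIN FAMILY OF `U(1,1)∕CM` IS `φ₀r · [𝟙_{w₁ ≤ T}]`, hence
NON-ZERO — the χ = 1 payer of K2E1-p15's (ii) letter `hne` («L²-residue ≠ 0») and of C9's residue bookkeeping.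
-/
import Summits.HodgeConjecture.HodgeConjecture.Theorems.K2E1SphericalEisensteinL2ResidueCMTwo   -- THIS SEAT ★ p860232 (γ): the `L²` residue exists from (MS-1); brings ★ p860098, ★ p859977, ★ BL spaces, ★ `siegel_two`
import Summits.HodgeConjecture.HodgeConjecture.Theorems.K2E1BLHeckeOperatorHXU2              -- ★ (K2E1 BL road): `supHeight_toAutomorphicQuotient` (rank-generic)
import HarnessLib

/-!
# K2·E1 — `K2E1SphericalEisensteinL2ResidueIndicatorCMTwo` (`U(1,1)_{L/L⁺}`): `Res_T =ᵐ φ₀·r·𝟙_{w₁ ≤ T}` AND `Res_T ≠ 0` — the `L²` residue class of the truncated spherical Eisenstein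
# family at `z = 1` is the (non-zero) multiple `φ₀r` of the indicator of the compact core `{w₁ ≤ T}`

Track B ∕ K2-LIT, crux h413 = `stmt-HodgeConjecture-24833`, route of record `HCCMUnconditional`; cell `hodgecm-mathlib`, squad K2, ENGINE E1.  Prover seat `hodgecm-mathlib-K2E1-p12` (g2);
dealer K2E1-plan (g7) (182) («P4 pays K2E1-p15's (ii) letter `hne` («L²-residue ≠ 0») at χ = 1 and C9's residue bookkeeping») on top of the completed (137)∕P4 and (225) chains.  THEOREMS
ONLY (no `def`, no `instance`, no notation, no named-fact hypothesis, no `sorry`); lane `--supports stmt-HodgeConjecture-24833 --as helper` (count-neutral).  Closes no socket.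

THE MATHEMATICS ([MoeglinWaldspurger1995, IV.1.11, I.2.13]; [Langlands1976, §7]; [BernsteinLapid2019, §4 p. 10]).  By ★ p859977 §3 the `L²` residue class of `F_T(z) =ᵐ Λ^T Ẽ(z)` at `1`
is `Res_T(x) = F x̃⁻¹ 1 − 𝟙[T < w₁ x]·φ₀r` a.e., and by ★ p860098 (`residueValue_eq_const_cm_two`) the residue function is the constant `φ₀r`; hence
**`Res_T =ᵐ (x ↦ if T < w₁ x then 0 else φ₀r) = φ₀r·𝟙_{w₁ ≤ T}`** (§2 `L2Residue_ae_eq_indicator`).  The core `{w₁ ≤ T}` has POSITIVE measure for every `T > 1` (§1): by the Siegel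
property ★ `siegel_two` (`H(γg)·H(g) ≤ 1` off `B(F)`), a point `g` with `1 ≤ H(g)` has `w₁[g⁻¹] = H(g)` (`supHeight_toAutomorphicQuotient_inv_eq`); heights take every positive value
along the torus (★ `exists_torus_posRealIdele_two`, §1 `exists_borelHeight_eq_two`), so the open set `{1 < H < T}` is non-empty and its image in `𝔛` — open (`QuotientGroup.isOpenMap_coe`),
inside `{w₁ ≤ T}` — is charged by the automorphic measure (`IsOpenPosMeasure`).  Therefore **`Res_T ≠ 0`** whenever `φ₀ ≠ 0`, `r ≠ 0`, `T > 1` (§2 `L2Residue_ne_zero`); the `_of_ms`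
forms take the single Maass–Selberg letter (MS-1) (★ β3 `ms1_of_road`) instead of `(Res, hRes)`.
* §1 (generic `F E c`, `U(J₂)`, `c² = 1`) `exists_borelHeight_eq_two`, `supHeight_toAutomorphicQuotient_inv_eq`, **`measure_setOf_supHeight_le_ne_zero`** (`1 < T`).
* §2 (`U(1,1)∕CM`) **`L2Residue_ae_eq_indicator`**, **`L2Residue_ne_zero`**, `exists_L2Residue_ae_eq_indicator_of_ms` (∃-form from (MS-1), with the non-vanishing clause).
HONEST LABEL: HC_CM is proved only modulo the 7 printed citations (2 remaining named inputs: hLiu418 = `stmt-HodgeConjecture-24832`, h413 = `stmt-HodgeConjecture-24833`) until rung 0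
closes; this file asserts no named fact and closes no socket; visible letters as in ★ p860098 ∕ ★ γ (EXPORTS₂ clauses, (F), `hcres`, the operator road's family); `T > 1` for §1∕`ne_zero`.
References: [MoeglinWaldspurger1995] I.2.13, IV.1.11 · [Langlands1976] §7 · [BernsteinLapid2019] §4 p. 10 · [Borel1963] §5.
-/

set_option autoImplicit false
-- the mandated namespace repeats the single-problem summit's segment (`HodgeConjecture.HodgeConjecture`)
set_option linter.dupNamespace false

noncomputable section

open MeasureTheory Measure NumberField IsDedekindDomain Set Filter Topology Metric
open scoped ENNReal NNReal
open Literature.NumberTheory.Automorphic Literature.NumberTheory.Automorphic.UnitaryGroup AdelicGroupData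
open Summit.HodgeConjecture.HodgeConjecture.Cruxes.H413.K2E1BorelEisensteinU
open Summit.HodgeConjecture.HodgeConjecture.Cruxes.H413.K2E1BLBorelSpacesU2Defs
open Summit.HodgeConjecture.HodgeConjecture.Cruxes.H413.K2E1BLHeckeOperatorHXU2 (supHeight_toAutomorphicQuotient)
open Summit.HodgeConjecture.HodgeConjecture.Cruxes.H413.K2E1BLHeckeOperatorWeightedU2 (bddAbove_range_borelHeight_arith_mul)
open Summit.HodgeConjecture.HodgeConjecture.Cruxes.H413.K2E1BLHeightCosetsU2 (exists_torus_posRealIdele_two)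
open Summit.HodgeConjecture.HodgeConjecture.Cruxes.H413.K2E1TruncatedEisensteinExplicit (siegel_two borelHeight_arithmeticBorel_mul)
open Summit.HodgeConjecture.HodgeConjecture.Cruxes.H413.K2E1HeightFunctionU3 (borelHeight_one)
open Summit.HodgeConjecture.HodgeConjecture.Cruxes.H413.K2E1ContinuedEisensteinResidueFunctionUTwo (ae_eq_residueValue_sub_indicator)
open Summit.HodgeConjecture.HodgeConjecture.Cruxes.H413.K2E1SphericalEisensteinResidueCuspidalCMTwo (residueValue_eq_const_cm_two)
open Summit.HodgeConjecture.HodgeConjecture.Cruxes.H413.K2E1SphericalEisensteinL2ResidueCMTwo (exists_tendsto_sub_smul_of_differentiableOn)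

namespace Summit.HodgeConjecture.HodgeConjecture.Cruxes.H413.K2E1SphericalEisensteinL2ResidueIndicatorCMTwo

/-! ## §1 `U(J₂)`: heights take every value; `w₁[g⁻¹] = H(g)` above the floor; the core `{w₁ ≤ T}` has positive measure for `T > 1` -/

section Core

variable {F E : Type} [Field F] [NumberField F] [Field E] [NumberField E] [Algebra F E] {c : E ≃ₐ[F] E}

/-- **HEIGHTS TAKE EVERY POSITIVE VALUE** on `U(J₂)(𝔸_F)` (`c² = 1`): the torus elements `d(z_E(ρ), z_E(ρ)⁻¹)` scale the height by `ρ^{[E:ℚ]}` (★ `exists_torus_posRealIdele_two`), and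
`ρ ↦ ρ^{[E:ℚ]}` is onto `(0, ∞)`. [cite: Borel1963, §5] [cite: Rogawski1990, §2.2] -/
theorem exists_borelHeight_eq_two (hc : c * c = 1) {s : ℝ≥0} (hs : 0 < s) : ∃ g : (quasiSplit F E c 2).Adelic, borelHeight g = s := by
  have hd0 : Module.finrank ℚ E ≠ 0 := Module.finrank_pos.ne'
  have hH₁ : 0 < borelHeight (1 : (quasiSplit F E c 2).Adelic) := borelHeight_pos _
  obtain ⟨ρ, hρ0, hρd⟩ : ∃ ρ : ℝ≥0, ρ ≠ 0 ∧ ρ ^ Module.finrank ℚ E * borelHeight (1 : (quasiSplit F E c 2).Adelic) = s := by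
    refine ⟨(s / borelHeight (1 : (quasiSplit F E c 2).Adelic)) ^ ((Module.finrank ℚ E : ℝ)⁻¹), (NNReal.rpow_pos (div_pos hs hH₁)).ne', ?_⟩
    rw [NNReal.rpow_inv_natCast_pow _ hd0, div_mul_cancel₀ _ hH₁.ne']
  obtain ⟨t, -, -, ht⟩ := exists_torus_posRealIdele_two (F := F) (E := E) (c := c) hc (Units.mk0 ρ hρ0)
  have h1 := ht 1
  rw [mul_one, Units.val_mk0] at h1
  exact ⟨_, h1.trans hρd⟩

/-- **ABOVE THE FLOOR THE TOP HEIGHT IS THE HEIGHT**: if `1 ≤ H(g)` then `w₁[g⁻¹] = ⨆_γ H(γ g) = H(g)` — the Siegel property ★ `siegel_two` (`H(γg)·H(g) ≤ 1` for `γ ∉ B(F)`) and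
`H(βg) = H(g)` for `β ∈ B(F)`. [cite: Garrett2018, §2.3] [cite: BernsteinLapid2019, §4 p. 10] -/
theorem supHeight_toAutomorphicQuotient_inv_eq {g : (quasiSplit F E c 2).Adelic} (hg : 1 ≤ borelHeight g) :
    supHeight F E c 2 ((quasiSplit F E c 2).toAutomorphicQuotient g⁻¹) = borelHeight g := by
  rw [supHeight_toAutomorphicQuotient, inv_inv]
  refine le_antisymm (ciSup_le fun γ => ?_) ?_
  · -- `Classical.em`, not `by_cases`: the `Decidable (γ ∈ B(F))` instance search times out
    rcases Classical.em (γ ∈ arithmeticBorel F E c 2) with hγ | hγ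
    · exact (borelHeight_arithmeticBorel_mul (N := 2) hγ g).le
    · have hS := siegel_two γ hγ g
      have h1 : borelHeight ((γ : (quasiSplit F E c 2).Adelic) * g) ≤ 1 := by
        refine le_of_not_gt fun hlt => ?_
        have : 1 < borelHeight ((γ : (quasiSplit F E c 2).Adelic) * g) * borelHeight g := by
          calc (1 : ℝ≥0) = 1 * 1 := (one_mul 1).symm
            _ < _ := mul_lt_mul_of_pos_of_nonneg' hlt hg zero_lt_one (le_trans zero_le_one hlt.le)
        exact (not_le.2 this) hS
      exact h1.trans hg
  · have h1 := le_ciSup (bddAbove_range_borelHeight_arith_mul g) (1 : (quasiSplit F E c 2).arithmeticSubgroup)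
    rwa [OneMemClass.coe_one, one_mul] at h1

/-- **THE CORE `{w₁ ≤ T}` HAS POSITIVE MEASURE** for every automorphic measure and every `T > 1` (`c² = 1`): it contains the image in `𝔛` of the non-empty open set `{g | 1 < H(g) < T}`
under the open map `g ↦ [g⁻¹]`, and automorphic measures charge open sets. [cite: BernsteinLapid2019, §4 p. 10] [cite: MoeglinWaldspurger1995, I.2.13] -/
theorem measure_setOf_supHeight_le_ne_zero (hc : c * c = 1) (μ : Measure (quasiSplit F E c 2).automorphicQuotient) [(quasiSplit F E c 2).IsAutomorphicMeasure μ]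
    {T : ℝ≥0} (hT : 1 < T) : μ {x : (quasiSplit F E c 2).automorphicQuotient | supHeight F E c 2 x ≤ T} ≠ 0 := by
  set O : Set (quasiSplit F E c 2).Adelic := {g | (1 : ℝ) < (borelHeight g : ℝ) ∧ ((borelHeight g : ℝ≥0) : ℝ) < (T : ℝ)} with hO
  have hHc : Continuous fun g : (quasiSplit F E c 2).Adelic => ((borelHeight g : ℝ≥0) : ℝ) := NNReal.continuous_coe.comp continuous_borelHeight
  have hOo : IsOpen O := (isOpen_lt continuous_const hHc).inter (isOpen_lt hHc continuous_const)
  have hOinv : IsOpen O⁻¹ := hOo.inv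
  set V : Set (quasiSplit F E c 2).automorphicQuotient := (quasiSplit F E c 2).toAutomorphicQuotient '' O⁻¹ with hV
  have hVo : IsOpen V := QuotientGroup.isOpenMap_coe _ hOinv
  -- `V` is non-empty: a point of height `(1 + T)∕2`
  have hs : (0 : ℝ≥0) < (1 + T) / 2 := by positivity
  obtain ⟨g, hg⟩ := exists_borelHeight_eq_two (F := F) (E := E) (c := c) hc hs
  have hT' : (1 : ℝ) < (T : ℝ) := by exact_mod_cast hT
  have hgO : g ∈ O := by
    show (1 : ℝ) < (borelHeight g : ℝ) ∧ ((borelHeight g : ℝ≥0) : ℝ) < (T : ℝ)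
    rw [hg, NNReal.coe_div, NNReal.coe_add, NNReal.coe_one, NNReal.coe_ofNat]
    constructor <;> linarith
  have hVne : V.Nonempty := ⟨_, g⁻¹, by rwa [Set.mem_inv, inv_inv], rfl⟩
  -- `V ⊆ {w₁ ≤ T}`
  have hVsub : V ⊆ {x : (quasiSplit F E c 2).automorphicQuotient | supHeight F E c 2 x ≤ T} := by
    rintro _ ⟨h, hh, rfl⟩
    have hh' : h⁻¹ ∈ O := hh
    have h1 : (1 : ℝ≥0) ≤ borelHeight h⁻¹ := by exact_mod_cast hh'.1.le
    have h2 : borelHeight h⁻¹ ≤ T := by exact_mod_cast hh'.2.le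
    show supHeight F E c 2 ((quasiSplit F E c 2).toAutomorphicQuotient h) ≤ T
    have heq := supHeight_toAutomorphicQuotient_inv_eq (F := F) (E := E) (c := c) (g := h⁻¹) h1
    rw [inv_inv] at heq
    rw [heq]
    exact h2
  exact fun h0 => (hVo.measure_ne_zero μ hVne) (measure_mono_null hVsub h0)

end Core

/-! ## §2 `U(1,1)∕CM`: the residue class is `φ₀r·𝟙_{w₁ ≤ T}` a.e., and is non-zero -/

section CM

variable (L : Type) [Field L] [NumberField L] [IsCMField L]
variable [MeasurableSpace (quasiSplit (↥(maximalRealSubfield L)) L (IsCMField.complexConj L) 2).Adelic] [BorelSpace (quasiSplit (↥(maximalRealSubfield L)) L (IsCMField.complexConj L) 2).Adelic]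

/-- **`Res_T =ᵐ φ₀r · 𝟙_{w₁ ≤ T}`**: for the operator road's family `F_T(z) =ᵐ Λ^T Ẽ(z)` with `L²` residue `Res_T = lim (z − 1)•F_T(z)`, the class `Res_T` is represented by
`x ↦ if T < w₁ x then 0 else φ₀·r` — ★ p859977 §3 (`Res_T(x) = F x̃⁻¹ 1 − 𝟙[T<w₁]φ₀r`) and ★ p860098 (`F g 1 = φ₀r` for every `g`).  Binders = ★ `residueValue_eq_const_cm_two`'s VERBATIM.
[cite: MoeglinWaldspurger1995, IV.1.11, I.2.13] [cite: Langlands1976, §7] -/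
theorem L2Residue_ae_eq_indicator
    (μ : Measure (quasiSplit (↥(maximalRealSubfield L)) L (IsCMField.complexConj L) 2).automorphicQuotient) [(quasiSplit (↥(maximalRealSubfield L)) L (IsCMField.complexConj L) 2).IsAutomorphicMeasure μ]
    (ν : Measure ↥(adelicUnipotent (↥(maximalRealSubfield L)) L (IsCMField.complexConj L) 2)) [ν.IsHaarMeasure]
    {𝓕 : Set ↥(adelicUnipotent (↥(maximalRealSubfield L)) L (IsCMField.complexConj L) 2)}
    (h𝓕N : IsFundamentalDomain ↥(rationalUnipotent (↥(maximalRealSubfield L)) L (IsCMField.complexConj L) 2) 𝓕 ν) (h𝓕c : IsCompact (closure 𝓕))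
    (φ₀ : ℂ) {T : ℝ≥0} (hT : 1 ≤ T)
    (Ec : ℂ → (quasiSplit (↥(maximalRealSubfield L)) L (IsCMField.complexConj L) 2).Adelic → ℂ) {D : Set ℂ} (hDo : IsOpen D) (hDc : IsPreconnected D)
    {σ₀ : ℝ} (hσ₀ : 1 < σ₀) (hσD : ∀ᶠ z in 𝓝 ((σ₀ : ℝ) : ℂ), z ∈ D) {ρ : ℝ} (hρ : 0 < ρ) (hρD : ∀ z : ℂ, z ≠ 1 → dist z 1 < ρ → z ∈ D)
    (hEd : ∀ g, DifferentiableOn ℂ (fun z => Ec z g) D) (hE4 : ∀ z ∈ D, Continuous (Ec z))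
    (hEbd : ∀ z₀ ∈ D, ∀ K : Set (quasiSplit (↥(maximalRealSubfield L)) L (IsCMField.complexConj L) 2).Adelic, IsCompact K → ∃ V ∈ 𝓝 z₀, ∃ M : ℝ, ∀ z ∈ V, ∀ g ∈ K, ‖Ec z g‖ ≤ M)
    (hEcinv : ∀ z ∈ D, ∀ (γ : (quasiSplit (↥(maximalRealSubfield L)) L (IsCMField.complexConj L) 2).arithmeticSubgroup) (x : (quasiSplit (↥(maximalRealSubfield L)) L (IsCMField.complexConj L) 2).Adelic),
      Ec z ((γ : (quasiSplit (↥(maximalRealSubfield L)) L (IsCMField.complexConj L) 2).Adelic) * x) = Ec z x)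
    (hE2 : ∀ z ∈ D, 1 < z.re → Ec z = eisensteinSeriesU (flatSectionU (fun _ : (quasiSplit (↥(maximalRealSubfield L)) L (IsCMField.complexConj L) 2).Adelic => φ₀) z))
    {cc : ℂ → ℂ} {r : ℂ} (hcres : Tendsto (fun z : ℂ => (z - 1) * cc z) (𝓝[≠] 1) (𝓝 r))
    (hE3 : ∀ z ∈ D, ∀ g : (quasiSplit (↥(maximalRealSubfield L)) L (IsCMField.complexConj L) 2).Adelic,
      borelConstantTerm ν 𝓕 (Ec z) g = φ₀ * ((((borelHeight g : ℝ≥0) : ℝ) : ℂ) ^ z + cc z * (((borelHeight g : ℝ≥0) : ℝ) : ℂ) ^ (1 - z)))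
    (Fp : (quasiSplit (↥(maximalRealSubfield L)) L (IsCMField.complexConj L) 2).Adelic → ℂ → ℂ) (hF : ∀ g, AnalyticAt ℂ (Fp g) 1) (hFE : ∀ g, Fp g =ᶠ[𝓝[≠] 1] fun z => (z - 1) * Ec z g)
    (Fam : ℂ → (quasiSplit (↥(maximalRealSubfield L)) L (IsCMField.complexConj L) 2).L2 μ) (hFd : DifferentiableOn ℂ Fam D)
    (hFam : ∀ z ∈ D, ((Fam z : (quasiSplit (↥(maximalRealSubfield L)) L (IsCMField.complexConj L) 2).L2 μ) : (quasiSplit (↥(maximalRealSubfield L)) L (IsCMField.complexConj L) 2).automorphicQuotient → ℂ) =ᵐ[μ]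
      (quasiSplit (↥(maximalRealSubfield L)) L (IsCMField.complexConj L) 2).quotFun (truncation ν 𝓕 T (Ec z)))
    (Res : (quasiSplit (↥(maximalRealSubfield L)) L (IsCMField.complexConj L) 2).L2 μ) (hRes : Tendsto (fun z : ℂ => (z - 1) • Fam z) (𝓝[≠] 1) (𝓝 Res)) :
    ((Res : (quasiSplit (↥(maximalRealSubfield L)) L (IsCMField.complexConj L) 2).L2 μ) : (quasiSplit (↥(maximalRealSubfield L)) L (IsCMField.complexConj L) 2).automorphicQuotient → ℂ) =ᵐ[μ] fun x =>
      if T < supHeight (↥(maximalRealSubfield L)) L (IsCMField.complexConj L) 2 x then 0 else φ₀ * r := by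
  have hD1 : ∀ᶠ z in 𝓝[≠] (1 : ℂ), z ∈ D := by
    filter_upwards [inter_mem_nhdsWithin _ (ball_mem_nhds (1 : ℂ) hρ)] with z hz
    exact hρD z hz.1 (mem_ball.1 hz.2)
  have hval := residueValue_eq_const_cm_two L μ ν h𝓕N h𝓕c φ₀ hT Ec hDo hDc hσ₀ hσD hρ hρD hEd hE4 hEbd hEcinv hE2 hcres hE3 Fp hF hFE Fam hFd hFam Res hRes
  filter_upwards [ae_eq_residueValue_sub_indicator μ ν h𝓕N hT φ₀ Ec hD1 hEcinv hcres hE3 Fp hF hFE Fam hFam Res hRes] with x hx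
  rw [hx, hval]
  split_ifs
  · rw [sub_self]
  · rw [sub_zero]

/-- **`Res_T ≠ 0`** (the χ = 1 payer of the letter `hne`): under the same binders, if `φ₀ ≠ 0`, `r ≠ 0` and `T > 1`, the `L²` residue class is non-zero — it is `φ₀r ≠ 0` on the core
`{w₁ ≤ T}`, which has positive measure (§1). [cite: MoeglinWaldspurger1995, IV.1.11] [cite: Langlands1976, §7] [cite: BernsteinLapid2019, §4 p. 10] -/
theorem L2Residue_ne_zero
    (μ : Measure (quasiSplit (↥(maximalRealSubfield L)) L (IsCMField.complexConj L) 2).automorphicQuotient) [(quasiSplit (↥(maximalRealSubfield L)) L (IsCMField.complexConj L) 2).IsAutomorphicMeasure μ]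
    (ν : Measure ↥(adelicUnipotent (↥(maximalRealSubfield L)) L (IsCMField.complexConj L) 2)) [ν.IsHaarMeasure]
    {𝓕 : Set ↥(adelicUnipotent (↥(maximalRealSubfield L)) L (IsCMField.complexConj L) 2)}
    (h𝓕N : IsFundamentalDomain ↥(rationalUnipotent (↥(maximalRealSubfield L)) L (IsCMField.complexConj L) 2) 𝓕 ν) (h𝓕c : IsCompact (closure 𝓕))
    {φ₀ : ℂ} (hφ₀ : φ₀ ≠ 0) {T : ℝ≥0} (hT : 1 < T)
    (Ec : ℂ → (quasiSplit (↥(maximalRealSubfield L)) L (IsCMField.complexConj L) 2).Adelic → ℂ) {D : Set ℂ} (hDo : IsOpen D) (hDc : IsPreconnected D)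
    {σ₀ : ℝ} (hσ₀ : 1 < σ₀) (hσD : ∀ᶠ z in 𝓝 ((σ₀ : ℝ) : ℂ), z ∈ D) {ρ : ℝ} (hρ : 0 < ρ) (hρD : ∀ z : ℂ, z ≠ 1 → dist z 1 < ρ → z ∈ D)
    (hEd : ∀ g, DifferentiableOn ℂ (fun z => Ec z g) D) (hE4 : ∀ z ∈ D, Continuous (Ec z))
    (hEbd : ∀ z₀ ∈ D, ∀ K : Set (quasiSplit (↥(maximalRealSubfield L)) L (IsCMField.complexConj L) 2).Adelic, IsCompact K → ∃ V ∈ 𝓝 z₀, ∃ M : ℝ, ∀ z ∈ V, ∀ g ∈ K, ‖Ec z g‖ ≤ M)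
    (hEcinv : ∀ z ∈ D, ∀ (γ : (quasiSplit (↥(maximalRealSubfield L)) L (IsCMField.complexConj L) 2).arithmeticSubgroup) (x : (quasiSplit (↥(maximalRealSubfield L)) L (IsCMField.complexConj L) 2).Adelic),
      Ec z ((γ : (quasiSplit (↥(maximalRealSubfield L)) L (IsCMField.complexConj L) 2).Adelic) * x) = Ec z x)
    (hE2 : ∀ z ∈ D, 1 < z.re → Ec z = eisensteinSeriesU (flatSectionU (fun _ : (quasiSplit (↥(maximalRealSubfield L)) L (IsCMField.complexConj L) 2).Adelic => φ₀) z))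
    {cc : ℂ → ℂ} {r : ℂ} (hr : r ≠ 0) (hcres : Tendsto (fun z : ℂ => (z - 1) * cc z) (𝓝[≠] 1) (𝓝 r))
    (hE3 : ∀ z ∈ D, ∀ g : (quasiSplit (↥(maximalRealSubfield L)) L (IsCMField.complexConj L) 2).Adelic,
      borelConstantTerm ν 𝓕 (Ec z) g = φ₀ * ((((borelHeight g : ℝ≥0) : ℝ) : ℂ) ^ z + cc z * (((borelHeight g : ℝ≥0) : ℝ) : ℂ) ^ (1 - z)))
    (Fp : (quasiSplit (↥(maximalRealSubfield L)) L (IsCMField.complexConj L) 2).Adelic → ℂ → ℂ) (hF : ∀ g, AnalyticAt ℂ (Fp g) 1) (hFE : ∀ g, Fp g =ᶠ[𝓝[≠] 1] fun z => (z - 1) * Ec z g)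
    (Fam : ℂ → (quasiSplit (↥(maximalRealSubfield L)) L (IsCMField.complexConj L) 2).L2 μ) (hFd : DifferentiableOn ℂ Fam D)
    (hFam : ∀ z ∈ D, ((Fam z : (quasiSplit (↥(maximalRealSubfield L)) L (IsCMField.complexConj L) 2).L2 μ) : (quasiSplit (↥(maximalRealSubfield L)) L (IsCMField.complexConj L) 2).automorphicQuotient → ℂ) =ᵐ[μ]
      (quasiSplit (↥(maximalRealSubfield L)) L (IsCMField.complexConj L) 2).quotFun (truncation ν 𝓕 T (Ec z)))
    (Res : (quasiSplit (↥(maximalRealSubfield L)) L (IsCMField.complexConj L) 2).L2 μ) (hRes : Tendsto (fun z : ℂ => (z - 1) • Fam z) (𝓝[≠] 1) (𝓝 Res)) :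
    Res ≠ 0 := by
  have hc : (IsCMField.complexConj L) * (IsCMField.complexConj L) = 1 := AlgEquiv.ext fun x => IsCMField.complexConj_apply_apply L x
  have hae := L2Residue_ae_eq_indicator L μ ν h𝓕N h𝓕c φ₀ hT.le Ec hDo hDc hσ₀ hσD hρ hρD hEd hE4 hEbd hEcinv hE2 hcres hE3 Fp hF hFE Fam hFd hFam Res hRes
  intro h0
  rw [h0] at hae
  have hzero : ∀ᵐ x ∂μ, (if T < supHeight (↥(maximalRealSubfield L)) L (IsCMField.complexConj L) 2 x then (0 : ℂ) else φ₀ * r) = 0 := by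
    filter_upwards [hae, Lp.coeFn_zero ℂ 2 μ] with x hx hx0
    rw [← hx, hx0, Pi.zero_apply]
  have hnull : μ {x : (quasiSplit (↥(maximalRealSubfield L)) L (IsCMField.complexConj L) 2).automorphicQuotient | supHeight (↥(maximalRealSubfield L)) L (IsCMField.complexConj L) 2 x ≤ T} = 0 := by
    refine measure_eq_zero_iff_ae_notMem.2 (hzero.mono fun x hx hle => ?_)
    have hle' : supHeight (↥(maximalRealSubfield L)) L (IsCMField.complexConj L) 2 x ≤ T := hle
    rw [if_neg (not_lt.2 hle')] at hx
    exact mul_ne_zero hφ₀ hr hx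
  exact measure_setOf_supHeight_le_ne_zero hc μ hT hnull

/-- **THE `L²` RESIDUE FROM (MS-1), WITH ITS INDICATOR FORM AND NON-VANISHING** — the ∃-form for consumers of ★ β3 `ms1_of_road`: `∃ Res, (z − 1)•F_T z → Res ∧ Res =ᵐ φ₀r·𝟙_{w₁ ≤ T} ∧
(1 < T → φ₀ ≠ 0 → r ≠ 0 → Res ≠ 0)`. [cite: MoeglinWaldspurger1995, IV.1.9–IV.1.11] [cite: BernsteinLapid2019, §4 p. 10] -/
theorem exists_L2Residue_ae_eq_indicator_of_ms
    (μ : Measure (quasiSplit (↥(maximalRealSubfield L)) L (IsCMField.complexConj L) 2).automorphicQuotient) [(quasiSplit (↥(maximalRealSubfield L)) L (IsCMField.complexConj L) 2).IsAutomorphicMeasure μ]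
    (ν : Measure ↥(adelicUnipotent (↥(maximalRealSubfield L)) L (IsCMField.complexConj L) 2)) [ν.IsHaarMeasure]
    {𝓕 : Set ↥(adelicUnipotent (↥(maximalRealSubfield L)) L (IsCMField.complexConj L) 2)}
    (h𝓕N : IsFundamentalDomain ↥(rationalUnipotent (↥(maximalRealSubfield L)) L (IsCMField.complexConj L) 2) 𝓕 ν) (h𝓕c : IsCompact (closure 𝓕))
    (φ₀ : ℂ) {T : ℝ≥0} (hT : 1 ≤ T)
    (Ec : ℂ → (quasiSplit (↥(maximalRealSubfield L)) L (IsCMField.complexConj L) 2).Adelic → ℂ) {D : Set ℂ} (hDo : IsOpen D) (hDc : IsPreconnected D)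
    {σ₀ : ℝ} (hσ₀ : 1 < σ₀) (hσD : ∀ᶠ z in 𝓝 ((σ₀ : ℝ) : ℂ), z ∈ D) {ρ : ℝ} (hρ : 0 < ρ) (hρD : ∀ z : ℂ, z ≠ 1 → dist z 1 < ρ → z ∈ D)
    (hEd : ∀ g, DifferentiableOn ℂ (fun z => Ec z g) D) (hE4 : ∀ z ∈ D, Continuous (Ec z))
    (hEbd : ∀ z₀ ∈ D, ∀ K : Set (quasiSplit (↥(maximalRealSubfield L)) L (IsCMField.complexConj L) 2).Adelic, IsCompact K → ∃ V ∈ 𝓝 z₀, ∃ M : ℝ, ∀ z ∈ V, ∀ g ∈ K, ‖Ec z g‖ ≤ M)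
    (hEcinv : ∀ z ∈ D, ∀ (γ : (quasiSplit (↥(maximalRealSubfield L)) L (IsCMField.complexConj L) 2).arithmeticSubgroup) (x : (quasiSplit (↥(maximalRealSubfield L)) L (IsCMField.complexConj L) 2).Adelic),
      Ec z ((γ : (quasiSplit (↥(maximalRealSubfield L)) L (IsCMField.complexConj L) 2).Adelic) * x) = Ec z x)
    (hE2 : ∀ z ∈ D, 1 < z.re → Ec z = eisensteinSeriesU (flatSectionU (fun _ : (quasiSplit (↥(maximalRealSubfield L)) L (IsCMField.complexConj L) 2).Adelic => φ₀) z))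
    {cc : ℂ → ℂ} {r : ℂ} (hcres : Tendsto (fun z : ℂ => (z - 1) * cc z) (𝓝[≠] 1) (𝓝 r))
    (hE3 : ∀ z ∈ D, ∀ g : (quasiSplit (↥(maximalRealSubfield L)) L (IsCMField.complexConj L) 2).Adelic,
      borelConstantTerm ν 𝓕 (Ec z) g = φ₀ * ((((borelHeight g : ℝ≥0) : ℝ) : ℂ) ^ z + cc z * (((borelHeight g : ℝ≥0) : ℝ) : ℂ) ^ (1 - z)))
    (Fp : (quasiSplit (↥(maximalRealSubfield L)) L (IsCMField.complexConj L) 2).Adelic → ℂ → ℂ) (hF : ∀ g, AnalyticAt ℂ (Fp g) 1) (hFE : ∀ g, Fp g =ᶠ[𝓝[≠] 1] fun z => (z - 1) * Ec z g)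
    (Fam : ℂ → (quasiSplit (↥(maximalRealSubfield L)) L (IsCMField.complexConj L) 2).L2 μ) (hFd : DifferentiableOn ℂ Fam D)
    (hFam : ∀ z ∈ D, ((Fam z : (quasiSplit (↥(maximalRealSubfield L)) L (IsCMField.complexConj L) 2).L2 μ) : (quasiSplit (↥(maximalRealSubfield L)) L (IsCMField.complexConj L) 2).automorphicQuotient → ℂ) =ᵐ[μ]
      (quasiSplit (↥(maximalRealSubfield L)) L (IsCMField.complexConj L) 2).quotFun (truncation ν 𝓕 T (Ec z)))
    (hMS1 : ∃ C : ℝ, ∀ᶠ z in 𝓝[≠] (1 : ℂ), ‖(z - 1) • Fam z‖ ≤ C) :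
    ∃ Res : (quasiSplit (↥(maximalRealSubfield L)) L (IsCMField.complexConj L) 2).L2 μ, Tendsto (fun z : ℂ => (z - 1) • Fam z) (𝓝[≠] 1) (𝓝 Res) ∧
      (((Res : (quasiSplit (↥(maximalRealSubfield L)) L (IsCMField.complexConj L) 2).L2 μ) : (quasiSplit (↥(maximalRealSubfield L)) L (IsCMField.complexConj L) 2).automorphicQuotient → ℂ) =ᵐ[μ] fun x =>
        if T < supHeight (↥(maximalRealSubfield L)) L (IsCMField.complexConj L) 2 x then 0 else φ₀ * r) ∧
      (1 < T → φ₀ ≠ 0 → r ≠ 0 → Res ≠ 0) := by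
  have hD1 : ∀ᶠ z in 𝓝[≠] (1 : ℂ), z ∈ D := by
    filter_upwards [inter_mem_nhdsWithin _ (ball_mem_nhds (1 : ℂ) hρ)] with z hz
    exact hρD z hz.1 (mem_ball.1 hz.2)
  obtain ⟨Res, hRes⟩ := exists_tendsto_sub_smul_of_differentiableOn hDo hD1 hFd hMS1
  exact ⟨Res, hRes, L2Residue_ae_eq_indicator L μ ν h𝓕N h𝓕c φ₀ hT Ec hDo hDc hσ₀ hσD hρ hρD hEd hE4 hEbd hEcinv hE2 hcres hE3 Fp hF hFE Fam hFd hFam Res hRes,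
    fun hT1 hφ₀ hr => L2Residue_ne_zero L μ ν h𝓕N h𝓕c hφ₀ hT1 Ec hDo hDc hσ₀ hσD hρ hρD hEd hE4 hEbd hEcinv hE2 hr hcres hE3 Fp hF hFE Fam hFd hFam Res hRes⟩

end CM

end Summit.HodgeConjecture.HodgeConjecture.Cruxes.H413.K2E1SphericalEisensteinL2ResidueIndicatorCMTwo

end
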